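import Literature.MathematicalPhysics.QuantumLattice.SpinChainsKnabeProofs
import Literature.MathematicalPhysics.QuantumLattice.SpinChainsAkltGroundStateProofs
import HarnessLib

/-!
# Spectral bookkeeping for frustration-free gap proofs

Sibling proof file of `Literature/MathematicalPhysics/QuantumLattice/LiebRobinson.lean`
(theorem-only: no definition, no named fact), a step towards the discharge of
`fannes_nachtergaele_werner_gap` (**hubbard.S16**; Fannes–Nachtergaele–Werner 1992, Thm. 6.4).
Finite-dimensional spectral lemmas for Hermitian matrices (`Matrix.HasSpectralGap`,
`Matrix.HasUniqueGroundState`, `Matrix.groundEnergy` of `FinDimSpectrum.lean`):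

* `exists_hasSpectralGap_of_hasUniqueGroundState` — a simple ground energy is accompanied by
  *some* gap `γ > 0` (used for the finitely many small rings not covered by the uniform bound);
* `rayleigh_ge_of_hasSpectralGap_of_orthogonal` — the second variational principle
  `(E₀ + Δ) φ†φ ≤ re φ† A φ` for `φ ⊥ ψ`, `ψ` the ground state of a gapped `A` (same statement as
  `Matrix.HasSpectralGap.le_rayleigh_of_orthogonal` of `HubbardLSMFillingProofs.lean`, reproved to
  keep the imports of this file light);
* `hasSpectralGap_of_dominated_sq_sub_smul` — **the spectral conclusion of FNW's Theorem 6.4**: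
  if `H ≥ 0` has kernel `ℂ ψ` and an auxiliary `K ≥ 0` satisfies `K ≤ c H`, `ker K ⊆ ker H` and
  `K² ≥ θ K`, then `H.HasSpectralGap (θ / c)` (FNW (6.6)–(6.8): `H ≥ γ_{2p} K`,
  `K² ≥ (1 - 2ε) K`, same kernel).

## Sources

* M. Fannes, B. Nachtergaele, R. F. Werner, Comm. Math. Phys. **144** (1992) 443–490, §6,
  proof of Theorem 6.4 (p. 478–479, inequalities (6.6)–(6.8) and "the positive operator `h` can
  be bounded from below by a multiple of the projection `𝟙 - G_{2p}` with the same kernel").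
  [FannesNachtergaeleWernerCMP1992]
* H. Tasaki, *Physics and Mathematics of Quantum Many-Body Systems* (2020), §2.1 (a unique
  ground state of a finite system has a nonzero gap; the variational principle). [Tasaki2020]
* S. Knabe, J. Stat. Phys. **52** (1988) 627, §2 (reading `H² ≥ ε H` as a gap), via
  `hasSpectralGap_of_sq_sub_smul_posSemidef` of `SpinChainsKnabeProofs.lean`.
-/

noncomputable section

open Matrix
open scoped ComplexOrder MatrixOrder InnerProductSpace

namespace Literature.MathematicalPhysics.QuantumLattice

section Spectral

variable {n : Type*} [Fintype n] [DecidableEq n]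

/-- **A unique ground state is gapped in finite volume.** A Hermitian matrix whose ground
energy is a simple eigenvalue has *some* spectral gap `γ > 0` (the distance to the next
eigenvalue, or any positive number if there is none). Tasaki (2020) §2.1 ("in a finite system,
a unique ground state is necessarily accompanied by a nonzero energy gap"). [folklore] -/
theorem exists_hasSpectralGap_of_hasUniqueGroundState {A : Matrix n n ℂ} (hA : A.IsHermitian)
    (huniq : A.HasUniqueGroundState) : ∃ γ : ℝ, 0 < γ ∧ A.HasSpectralGap γ := by
  classical
  set E₀ := A.groundEnergy
  set s : Finset n := Finset.univ.filter fun i => E₀ < hA.eigenvalues i with hs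
  have hcard : (Finset.univ.filter fun i => hA.eigenvalues i = E₀).card = 1 := by
    rw [hA.card_filter_eigenvalues_eq]; exact huniq
  by_cases hne : s.Nonempty
  · set γ : ℝ := s.inf' hne fun i => hA.eigenvalues i - E₀ with hγ
    have hγpos : 0 < γ := by
      rw [hγ, Finset.lt_inf'_iff]
      intro i hi
      rw [hs, Finset.mem_filter] at hi
      linarith [hi.2]
    refine ⟨γ, hγpos, (hA.hasSpectralGap_iff_card_filter γ).2 ⟨hγpos, hcard, ?_⟩⟩
    rintro _ ⟨i, rfl⟩
    rcases (groundEnergy_le_eigenvalues hA i).eq_or_lt with h | h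
    · exact Or.inl h.symm
    · refine Or.inr (Set.mem_Ici.2 ?_)
      have hi : i ∈ s := by rw [hs, Finset.mem_filter]; exact ⟨Finset.mem_univ _, h⟩
      have := Finset.inf'_le (fun i => hA.eigenvalues i - E₀) hi
      linarith
  · refine ⟨1, one_pos, (hA.hasSpectralGap_iff_card_filter 1).2 ⟨one_pos, hcard, ?_⟩⟩
    rintro _ ⟨i, rfl⟩
    rcases (groundEnergy_le_eigenvalues hA i).eq_or_lt with h | h
    · exact Or.inl h.symm
    · exact absurd ⟨i, by rw [hs, Finset.mem_filter]; exact ⟨Finset.mem_univ _, h⟩⟩ hne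

omit [DecidableEq n] in
/-- `x† y` is the Euclidean inner product of `x` and `y` (as elements of `ℓ²(n)`). [folklore] -/
theorem star_dotProduct_eq_inner' (x y : n → ℂ) :
    star x ⬝ᵥ y = ⟪(WithLp.toLp 2 x : EuclideanSpace ℂ n), WithLp.toLp 2 y⟫_ℂ := by
  rw [EuclideanSpace.inner_toLp_toLp, dotProduct_comm]

/-- **Second variational principle under a spectral gap** (Rayleigh bound on the orthogonal
complement of a simple ground state): if `A.HasSpectralGap Δ`, `A ψ = E₀ ψ` with `ψ ≠ 0` and
`ψ† φ = 0`, then `(E₀ + Δ) φ†φ ≤ re φ† A φ` (expand `φ` in an orthonormal eigenbasis: its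
coefficient along the one-dimensional ground space vanishes and all other eigenvalues are
`≥ E₀ + Δ`). Same statement as `Matrix.HasSpectralGap.le_rayleigh_of_orthogonal` of
`HubbardLSMFillingProofs` (reproved here to keep the imports light). Tasaki (2020) §2.1;
Reed–Simon IV, Thm. XIII.1. [folklore] -/
theorem rayleigh_ge_of_hasSpectralGap_of_orthogonal {A : Matrix n n ℂ} {Δ : ℝ}
    (h : A.HasSpectralGap Δ) {ψ φ : n → ℂ} (hψ0 : ψ ≠ 0)
    (hψ : A *ᵥ ψ = (A.groundEnergy : ℂ) • ψ) (horth : star ψ ⬝ᵥ φ = 0) :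
    (A.groundEnergy + Δ) * (star φ ⬝ᵥ φ).re ≤ (star φ ⬝ᵥ A *ᵥ φ).re := by
  have hA : A.IsHermitian := h.isHermitian
  obtain ⟨-, hcard, hrange⟩ := (hA.hasSpectralGap_iff_card_filter Δ).1 h
  obtain ⟨i₀, hi₀⟩ := Finset.card_eq_one.1 hcard
  have hother : ∀ i, i ≠ i₀ → A.groundEnergy + Δ ≤ hA.eigenvalues i := by
    intro i hi
    rcases hrange ⟨i, rfl⟩ with h0 | h1
    · exfalso
      have : i ∈ ({i₀} : Finset n) := by
        rw [← hi₀, Finset.mem_filter]; exact ⟨Finset.mem_univ _, h0⟩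
      exact hi (Finset.mem_singleton.1 this)
    · exact h1
  -- the eigenvector `b i₀` spans the ground space, hence is proportional to `ψ`, hence `⊥ φ`
  set b := hA.eigenvectorBasis with hb
  have hmemψ : ψ ∈ A.groundSpace := (mem_groundSpace_iff A ψ).2 hψ
  have hval : hA.eigenvalues i₀ = A.groundEnergy := by
    have : i₀ ∈ Finset.univ.filter fun i => hA.eigenvalues i = A.groundEnergy := by
      rw [hi₀]; exact Finset.mem_singleton_self _
    exact (Finset.mem_filter.1 this).2
  have hbi₀ : (b i₀).ofLp ∈ A.groundSpace := by
    rw [mem_groundSpace_iff, hA.mulVec_eigenvectorBasis i₀, hval, Complex.coe_smul]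
  have h1 : Module.finrank ℂ A.groundSpace = 1 := h.hasUniqueGroundState
  have hv : (⟨ψ, hmemψ⟩ : A.groundSpace) ≠ 0 := fun h0 => hψ0 (congrArg Subtype.val h0)
  obtain ⟨c, hc⟩ := (finrank_eq_one_iff_of_nonzero' _ hv).1 h1 ⟨(b i₀).ofLp, hbi₀⟩
  have hc' : (b i₀).ofLp = c • ψ := (congrArg Subtype.val hc).symm
  set x : EuclideanSpace ℂ n := WithLp.toLp 2 φ with hx
  have horth' : ⟪b i₀, x⟫_ℂ = 0 := by
    rw [EuclideanSpace.inner_eq_star_dotProduct, hc', star_smul, dotProduct_smul, dotProduct_comm,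
      horth, smul_zero]
  -- expansion in the eigenbasis
  set T := toEuclideanCLM (n := n) (𝕜 := ℂ) A with hT
  have hTb : ∀ i, T (b i) = (hA.eigenvalues i : ℂ) • b i := by
    intro i
    have h2 : T (b i) = WithLp.toLp 2 (A *ᵥ (b i).ofLp) := by rw [hT, ← toEuclideanCLM_toLp]
    rw [h2, hA.mulVec_eigenvectorBasis i]
    rfl
  have hsymm : ∀ i, ⟪b i, T x⟫_ℂ = (hA.eigenvalues i : ℂ) * ⟪b i, x⟫_ℂ := by
    intro i
    have hsa : IsSelfAdjoint T := (isSelfAdjoint_toEuclideanCLM_iff A).2 hA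
    rw [← ContinuousLinearMap.adjoint_inner_left, hsa.adjoint_eq, hTb, inner_smul_left,
      Complex.conj_ofReal]
  have hTx : T x = WithLp.toLp 2 (A *ᵥ φ) := by rw [hT, hx, toEuclideanCLM_toLp]
  have hquad : star φ ⬝ᵥ A *ᵥ φ = ∑ i, (hA.eigenvalues i : ℂ) * (⟪b i, x⟫_ℂ * star ⟪b i, x⟫_ℂ) := by
    rw [star_dotProduct_eq_inner', ← hx, ← hTx, ← b.sum_inner_mul_inner x (T x)]
    refine Finset.sum_congr rfl fun i _ => ?_
    rw [hsymm, ← inner_conj_symm x (b i)]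
    simp only [Complex.star_def]
    ring
  have hnorm : (star φ ⬝ᵥ φ).re = ∑ i, ‖⟪b i, x⟫_ℂ‖ ^ 2 := by
    rw [star_dotProduct_eq_inner', ← hx, b.sum_sq_norm_inner_right x,
      ← inner_self_eq_norm_sq (𝕜 := ℂ) x, RCLike.re_to_complex]
  have hquad_re : (star φ ⬝ᵥ A *ᵥ φ).re = ∑ i, hA.eigenvalues i * ‖⟪b i, x⟫_ℂ‖ ^ 2 := by
    rw [hquad, Complex.re_sum]
    refine Finset.sum_congr rfl fun i _ => ?_
    rw [Complex.star_def, Complex.mul_conj, ← Complex.ofReal_mul, Complex.ofReal_re,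
      Complex.normSq_eq_norm_sq]
  rw [hnorm, hquad_re, Finset.mul_sum]
  refine Finset.sum_le_sum fun i _ => ?_
  by_cases hi : i = i₀
  · subst hi
    rw [horth', norm_zero]
    simp
  · exact mul_le_mul_of_nonneg_right (hother i hi) (sq_nonneg _)

/-- **From a dominating gapped auxiliary operator to a spectral gap (the spectral conclusion of
Fannes–Nachtergaele–Werner's coarse-graining argument, Thm. 6.4).** Let `H ≥ 0` have the zero
mode `ψ ≠ 0` spanning its kernel, and let `K ≥ 0` be an auxiliary operator with `K ≤ c H`,
`ker K ⊆ ker H` and `K² ≥ θ K` (`θ, c > 0`). Then `H` has the unique gapped ground state `ψ`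
with gap `θ / c`: indeed `K ψ = 0`, `ker K = ℂ ψ`, so `K` has the simple ground energy `0` and
gap `θ` (`hasSpectralGap_of_sq_sub_smul_posSemidef`); every other eigenvector `b` of `H` is
orthogonal to `ψ`, whence `λ = b† H b ≥ c⁻¹ b† K b ≥ θ / c`. FNW (1992), proof of Thm. 6.4,
inequalities (6.6)–(6.8). [folklore] -/
theorem hasSpectralGap_of_dominated_sq_sub_smul {H K : Matrix n n ℂ} (hH : H.PosSemidef)
    (hK : K.PosSemidef) {ψ : n → ℂ} (hψ0 : ψ ≠ 0) (hHψ : H *ᵥ ψ = 0)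
    (huniq : ∀ φ : n → ℂ, H *ᵥ φ = 0 → ∃ a : ℂ, φ = a • ψ)
    (hker : ∀ φ : n → ℂ, K *ᵥ φ = 0 → H *ᵥ φ = 0)
    {θ c : ℝ} (hθ : 0 < θ) (hc : 0 < c)
    (hsq : (K * K - (θ : ℂ) • K).PosSemidef) (hdom : ((c : ℂ) • H - K).PosSemidef) :
    H.HasSpectralGap (θ / c) := by
  have hHh : H.IsHermitian := hH.1
  have hKh : K.IsHermitian := hK.1
  -- ground energies are `0`
  have hE₀H : H.groundEnergy = 0 :=
    groundEnergy_eq_of_posSemidef_sub hHh 0 (by simpa using hH) hψ0 (by simp [hHψ])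
  -- `K ψ = 0`
  have hKψ : K *ᵥ ψ = 0 := by
    have h1 : 0 ≤ star ψ ⬝ᵥ ((c : ℂ) • H - K) *ᵥ ψ := hdom.dotProduct_mulVec_nonneg ψ
    rw [sub_mulVec, smul_mulVec, hHψ, smul_zero, zero_sub, dotProduct_neg] at h1
    have h2 : 0 ≤ star ψ ⬝ᵥ K *ᵥ ψ := hK.dotProduct_mulVec_nonneg ψ
    have h3 : star ψ ⬝ᵥ K *ᵥ ψ = 0 := le_antisymm (neg_nonneg.1 h1) h2
    exact (hK.dotProduct_mulVec_zero_iff ψ).1 h3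
  have hE₀K : K.groundEnergy = 0 :=
    groundEnergy_eq_of_posSemidef_sub hKh 0 (by simpa using hK) hψ0 (by simp [hKψ])
  -- `K` has the unique ground state `ψ` and the gap `θ`
  have hGSK : K.groundSpace = ℂ ∙ ψ := by
    ext φ
    rw [mem_groundSpace_iff, hE₀K, Complex.ofReal_zero, zero_smul, Submodule.mem_span_singleton]
    constructor
    · intro h0
      obtain ⟨a, ha⟩ := huniq φ (hker φ h0)
      exact ⟨a, ha.symm⟩
    · rintro ⟨a, rfl⟩
      rw [mulVec_smul, hKψ, smul_zero]
  have huniqK : K.HasUniqueGroundState := by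
    rw [Matrix.HasUniqueGroundState, Matrix.groundStateDegeneracy, hGSK, finrank_span_singleton hψ0]
  have hgapK : K.HasSpectralGap θ := by
    refine hasSpectralGap_of_sq_sub_smul_posSemidef hKh huniqK hθ ?_
    simpa [hE₀K] using hsq
  -- the spectral gap of `H`
  rw [hHh.hasSpectralGap_iff_card_filter]
  refine ⟨div_pos hθ hc, ?_, ?_⟩
  · rw [hHh.card_filter_eigenvalues_eq]
    have hGSH : H.groundSpace = ℂ ∙ ψ := by
      ext φ
      rw [mem_groundSpace_iff, hE₀H, Complex.ofReal_zero, zero_smul, Submodule.mem_span_singleton]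
      constructor
      · intro h0
        obtain ⟨a, ha⟩ := huniq φ h0
        exact ⟨a, ha.symm⟩
      · rintro ⟨a, rfl⟩
        rw [mulVec_smul, hHψ, smul_zero]
    have huniqH : H.HasUniqueGroundState := by
      rw [Matrix.HasUniqueGroundState, Matrix.groundStateDegeneracy, hGSH,
        finrank_span_singleton hψ0]
    exact huniqH
  · rintro _ ⟨i, rfl⟩
    rw [hE₀H, Set.mem_union, Set.mem_singleton_iff, Set.mem_Ici, zero_add]
    set b : n → ℂ := (hHh.eigenvectorBasis i).ofLp with hb
    have hHb : H *ᵥ b = ((hHh.eigenvalues i : ℝ) : ℂ) • b := by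
      have h := hHh.mulVec_eigenvectorBasis i
      rw [RCLike.real_smul_eq_coe_smul (K := ℂ)] at h
      exact h
    have hbb : star b ⬝ᵥ b = 1 := by
      have h1 : ‖hHh.eigenvectorBasis i‖ = 1 := hHh.eigenvectorBasis.orthonormal.1 i
      rw [hb, dotProduct_comm, ← EuclideanSpace.inner_eq_star_dotProduct,
        inner_self_eq_norm_sq_to_K, h1]
      simp
    by_cases hl : hHh.eigenvalues i = 0
    · exact Or.inl hl
    · right
      -- `b ⊥ ψ`: `λ ψ† b = ψ† H b = (H ψ)† b = 0`
      have horth : star ψ ⬝ᵥ b = 0 := by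
        have h1 : star (H *ᵥ ψ) ⬝ᵥ b = star ψ ⬝ᵥ H *ᵥ b := by
          rw [star_mulVec, hHh.eq, dotProduct_mulVec]
        rw [hHψ, star_zero, zero_dotProduct, hHb, dotProduct_smul, smul_eq_mul] at h1
        exact (mul_eq_zero.1 h1.symm).resolve_left (by exact_mod_cast hl)
      -- `θ ≤ b† K b ≤ c b† H b = c λ`
      have hR := rayleigh_ge_of_hasSpectralGap_of_orthogonal hgapK hψ0 (by simp [hKψ, hE₀K]) horth
      rw [hE₀K, zero_add, hbb, Complex.one_re, mul_one] at hR
      have hd : 0 ≤ (star b ⬝ᵥ ((c : ℂ) • H - K) *ᵥ b).re :=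
        (Complex.nonneg_iff.1 (hdom.dotProduct_mulVec_nonneg b)).1
      rw [sub_mulVec, smul_mulVec, hHb, smul_smul, dotProduct_sub, dotProduct_smul, hbb,
        Complex.sub_re, smul_eq_mul, mul_one, ← Complex.ofReal_mul, Complex.ofReal_re] at hd
      rw [div_le_iff₀ hc]
      nlinarith

end Spectral

end Literature.MathematicalPhysics.QuantumLattice
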